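import Summits.AnomalousDissipation.AnomalousDissipation.Theses.StirringSphere
import Literature.Analysis.FluidPDE.StatisticalSolutionProofs
import HarnessLib

/-!
# Crux `HairyBallAlignment` (stmt-AnomalousDissipation-17155, route StirringSphere) — line `pole`

`Lines/pole.lean` (crux-strategist seat `planner-cstrat-stmt-AnomalousDissipation-17155-b1-0`,
2026-08-17). An ALTERNATIVE to the registered birth line (`Lines/birth.lean`: closed graph of the
bounded Foias–Prodi class over the sphere + set-valued hairy ball), with NO topology and NO
compactness: the aligned loud force is PINNED AT A POLE OF THE STIRRING SPHERE BY A LATTICE SYMMETRY.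

THE CRUX (`Summit.AnomalousDissipation.AnomalousDissipation.Theses.StirringSphere.HairyBallAlignment`):
`NoScreening → BoundedSphereStatistics → ∀ b = (b₀,b₁,b₂)` (the explicit stirring family)
`→ ∃ E ν₀ m₀ > 0, ∀ ν ∈ (0,ν₀), ∃ c ∈ S², ∃ μ` a Foias–Prodi stationary statistical solution of
`NS_ν(f_c)`, `f_c = Σ cᵢ bᵢ`, with integrable mean energy `≤ E` and injection `∫ (u, f_c) dμ ≥ m₀`.

THE LEVER (equivariant averaging at a fixed point of the symmetry group of the family). Let
`h = (½,½,½) ∈ T³` and `τ_h` the half-lattice translation `x ↦ x + h`. A Fourier mode of wave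
vector `k` is multiplied by `(−1)^{k₁+k₂+k₃}` under `τ_h`; the stirring family consists of `b₀, b₁`
(shell `|k|² = 1`: the modes `(0,0,1),(1,0,0),(0,1,0)`) and `b₂` (shell `|k|² = 2`: the modes
`(0,1,1),(1,0,1),(1,1,0)`), so
    `b₀ ∘ τ_h = −b₀`,  `b₁ ∘ τ_h = −b₁`,  `b₂ ∘ τ_h = +b₂`         (`stir_parity`, PROVED below).
Hence at the POLE `c = e₂` of the stirring sphere the force `f_{e₂} = b₂` is `τ_h`-invariant while the
two other response directions are `τ_h`-odd. The Foias–Prodi class of a `τ_h`-invariant force is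
stable under the push-forward `μ ↦ (τ_h)_* μ` (stub 1, `stub_shiftCovariance`: translation covariance
of stationary statistical solutions — pure bookkeeping on FMRT IV Def. 1.3, the torus analogue of the
LANDED reflection `v ↦ −v` symmetrisation `Theorems/TameRoughRigidityTameClosureSymmetrise.lean`,
`Theorems/EnsembleRigidityGPStatisticalRigidityDesaturation.lean`) and convex (stub 2,
`stub_midpointConvexity`), so with the bounded statistics `μ` of `NS_ν(b₂)` handed out by
`BoundedSphereStatistics` at the pole, the symmetrised statistics `μ̄ = ½(μ + (τ_h)_*μ)` is again
admissible with the same energy, and its response vector is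
    `y(μ̄) = (½(y₀ − y₀), ½(y₁ − y₁), ½(y₂ + y₂)) = (0, 0, y₂(μ))`  — ALIGNED WITH THE POLE.
`NoScreening` at `(e₂, μ̄)` gives `y₂(μ)² = |y(μ̄)|² ≥ m₀²`; the mean energy inequality (FMRT IV (1.31)
with `e₁ = 0, e₂ = ∞`, in tree `IsStationaryStatisticalSolution.energy_le_holds`) gives
`y₂(μ) = ∫ (u, b₂) dμ = injection ≥ ν · enstrophy ≥ 0`; hence injection `(μ) ≥ m₀`. The witness of
the crux at viscosity `ν` is `(c, μ) = (e₂, μ)` — the SAME direction at every `ν` (a pinned zero of the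
route's tangent field: `τ_h` acts on the sphere of forces by `diag(−1,−1,+1)`, whose fixed points are
the poles `±e₂`, and on the tangent plane at a pole by `−1`).

STUBS (2): `stub_shiftCovariance` (HARDEST, size L, zero mathematical risk: translation covariance of
the Foias–Prodi class — Haar invariance of the pairings, `τ_h`-invariance of the spectral enstrophy,
translated cylindrical tests), `stub_midpointConvexity` (size M: the class is convex, energy and
responses are affine in `μ`). PROVED here: the parity of the stirring family under `τ_h`
(`stir_parity`), continuity / smoothness of the family, the pole dictionary (`force_pole`), and the
composition `HairyBallAlignment_of : stub₁ → stub₂ → HairyBallAlignment` (kernel-checked, no `sorry`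
of its own). Neither stub mentions the stirring family, the sphere, `NoScreening`, boundedness in `ν`
or the summit: stub 1 is a symmetry statement about FMRT's Definition 1.3 for ONE force and ONE
translation, stub 2 its convexity — no costume, no shred.

What the line dodges: the birth line's hardest stub `stub_responseGraphClosed` (weak closedness of the
bounded Foias–Prodi class jointly in the direction `c`, via Prokhorov + Rellich tightness + lsc of the
enstrophy + shell bookkeeping) and its topological stub `stub_setValuedHairyBall` (Cellina selection +
hairy ball) are not needed at all.

What the line reveals (for the route's tenure planner, recorded in `Lines/pole.md` and the crux idea
`pinned-pole`): restricted to the poles `±e₂`, the rank-2 crux `NoScreening` is EQUIVALENT to a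
per-force injection floor for `b₂` ("every bounded stationary statistics of `NS_ν(b₂)` has injection
`≥ m₀`, uniformly in small `ν`"), and the aligned force does not wander: `SphereTransfer`'s
upper-hemicontinuity half is moot for the pinned witness.

Disproof used: none exists (`ledger crux ls`: no `Disproof.lean`, no `Negative/` for this crux on
2026-08-17). Negatives index (`GPEnergyCeiling`, `EnsembleCeilingBridge`, …): energy ceilings / bridges
for fixed forces — untouched (energy enters only as the hypothesis `≤ E`, existential over statistics).

References: Foias–Manley–Rosa–Temam 2001, Ch. IV §1.2 Def. 1.3, (1.29)–(1.34) [FMRTTurbulence2001];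
Frisch 1995 §6.1 (lattice symmetries of periodic flows) [Frisch1995]; Vishik–Fursikov 1988 Ch. VII
(homogeneous statistical solutions: translation push-forwards) [VishikFursikov1988].
-/

-- `Summit.<Summit>.<Problem>`: single-conjunct summit, the duplicated namespace component is mandated (CONVENTIONS §2).
set_option linter.dupNamespace false

noncomputable section

open MeasureTheory Filter Topology
open scoped InnerProductSpace RealInnerProductSpace ENNReal NNReal BigOperators
open Literature.Analysis.FunctionSpaces Literature.Analysis.FluidPDE
open Summit.AnomalousDissipation.AnomalousDissipation.Theses.StirringSphere

namespace Summit.AnomalousDissipation.AnomalousDissipation.Cruxes.HairyBallAlignment.Pole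

/-- Local notation: `L²(T³; ℝ³)`. -/
local notation "L2" => (Lp (EuclideanSpace ℝ (Fin 3)) 2 (volume : Measure (UnitAddTorus (Fin 3))))
/-- Local notation: the energy space `H`. -/
local notation "H3" => (Torus.energySpace (Fin 3))

/-! ## Vocabulary: the stirring family, the half-lattice shift, the pole -/

/-- The explicit STIRRING FAMILY `b = (b₀, b₁, b₂)` on `T³` — VERBATIM the tuple `b` pinned by the
hypothesis `b = ![…]` of every item of route StirringSphere (`b₀ = f_GP`, `b₁` its anti-cyclic cosine
partner, `b₂` on the shell `|k|² = 2`). -/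
def stir : Fin 3 → UnitAddTorus (Fin 3) → EuclideanSpace ℝ (Fin 3) :=
  ![(fun x : UnitAddTorus (Fin 3) => (Literature.Analysis.FluidPDE.Torus.stokesMode (Pi.single (2 : Fin 3) (1 : ℤ)) (EuclideanSpace.single (0 : Fin 3) (1 : ℝ)) false x
        + Literature.Analysis.FluidPDE.Torus.stokesMode (Pi.single (0 : Fin 3) (1 : ℤ)) (EuclideanSpace.single (1 : Fin 3) (1 : ℝ)) false x
        + Literature.Analysis.FluidPDE.Torus.stokesMode (Pi.single (1 : Fin 3) (1 : ℤ)) (EuclideanSpace.single (2 : Fin 3) (1 : ℝ)) false x : EuclideanSpace ℝ (Fin 3))),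
    (fun x : UnitAddTorus (Fin 3) => (Literature.Analysis.FluidPDE.Torus.stokesMode (Pi.single (1 : Fin 3) (1 : ℤ)) (EuclideanSpace.single (0 : Fin 3) (1 : ℝ)) true x
        + Literature.Analysis.FluidPDE.Torus.stokesMode (Pi.single (2 : Fin 3) (1 : ℤ)) (EuclideanSpace.single (1 : Fin 3) (1 : ℝ)) true x
        + Literature.Analysis.FluidPDE.Torus.stokesMode (Pi.single (0 : Fin 3) (1 : ℤ)) (EuclideanSpace.single (2 : Fin 3) (1 : ℝ)) true x : EuclideanSpace ℝ (Fin 3))),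
    (fun x : UnitAddTorus (Fin 3) => (Literature.Analysis.FluidPDE.Torus.stokesMode ![(0 : ℤ), 1, 1] (EuclideanSpace.single (0 : Fin 3) (1 : ℝ)) false x
        + Literature.Analysis.FluidPDE.Torus.stokesMode ![(1 : ℤ), 0, 1] (EuclideanSpace.single (1 : Fin 3) (1 : ℝ)) false x
        + Literature.Analysis.FluidPDE.Torus.stokesMode ![(1 : ℤ), 1, 0] (EuclideanSpace.single (2 : Fin 3) (1 : ℝ)) false x : EuclideanSpace ℝ (Fin 3)))]

/-- `stir` IS the route's literal (by `rfl`): the term to feed the items' `b = ![…]` binder. -/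
theorem stir_eq : stir = ![(fun x : UnitAddTorus (Fin 3) => (Literature.Analysis.FluidPDE.Torus.stokesMode (Pi.single (2 : Fin 3) (1 : ℤ)) (EuclideanSpace.single (0 : Fin 3) (1 : ℝ)) false x + Literature.Analysis.FluidPDE.Torus.stokesMode (Pi.single (0 : Fin 3) (1 : ℤ)) (EuclideanSpace.single (1 : Fin 3) (1 : ℝ)) false x + Literature.Analysis.FluidPDE.Torus.stokesMode (Pi.single (1 : Fin 3) (1 : ℤ)) (EuclideanSpace.single (2 : Fin 3) (1 : ℝ)) false x : EuclideanSpace ℝ (Fin 3))), (fun x : UnitAddTorus (Fin 3) => (Literature.Analysis.FluidPDE.Torus.stokesMode (Pi.single (1 : Fin 3) (1 : ℤ)) (EuclideanSpace.single (0 : Fin 3) (1 : ℝ)) true x + Literature.Analysis.FluidPDE.Torus.stokesMode (Pi.single (2 : Fin 3) (1 : ℤ)) (EuclideanSpace.single (1 : Fin 3) (1 : ℝ)) true x + Literature.Analysis.FluidPDE.Torus.stokesMode (Pi.single (0 : Fin 3) (1 : ℤ)) (EuclideanSpace.single (2 : Fin 3) (1 : ℝ)) true x : EuclideanSpace ℝ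 (Fin 3))), (fun x : UnitAddTorus (Fin 3) => (Literature.Analysis.FluidPDE.Torus.stokesMode ![(0 : ℤ), 1, 1] (EuclideanSpace.single (0 : Fin 3) (1 : ℝ)) false x + Literature.Analysis.FluidPDE.Torus.stokesMode ![(1 : ℤ), 0, 1] (EuclideanSpace.single (1 : Fin 3) (1 : ℝ)) false x + Literature.Analysis.FluidPDE.Torus.stokesMode ![(1 : ℤ), 1, 0] (EuclideanSpace.single (2 : Fin 3) (1 : ℝ)) false x : EuclideanSpace ℝ (Fin 3)))] := rfl

/-- `b₀ = f_GP` (unfolding the tuple; `rfl`). -/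
theorem stir_zero : stir 0 = fun x : UnitAddTorus (Fin 3) =>
    (Torus.stokesMode (Pi.single (2 : Fin 3) (1 : ℤ)) (EuclideanSpace.single (0 : Fin 3) (1 : ℝ)) false x
      + Torus.stokesMode (Pi.single (0 : Fin 3) (1 : ℤ)) (EuclideanSpace.single (1 : Fin 3) (1 : ℝ)) false x
      + Torus.stokesMode (Pi.single (1 : Fin 3) (1 : ℤ)) (EuclideanSpace.single (2 : Fin 3) (1 : ℝ)) false x : EuclideanSpace ℝ (Fin 3)) := rfl

/-- `b₁` (unfolding the tuple; `rfl`). -/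
theorem stir_one : stir 1 = fun x : UnitAddTorus (Fin 3) =>
    (Torus.stokesMode (Pi.single (1 : Fin 3) (1 : ℤ)) (EuclideanSpace.single (0 : Fin 3) (1 : ℝ)) true x
      + Torus.stokesMode (Pi.single (2 : Fin 3) (1 : ℤ)) (EuclideanSpace.single (1 : Fin 3) (1 : ℝ)) true x
      + Torus.stokesMode (Pi.single (0 : Fin 3) (1 : ℤ)) (EuclideanSpace.single (2 : Fin 3) (1 : ℝ)) true x : EuclideanSpace ℝ (Fin 3)) := rfl

/-- `b₂` (unfolding the tuple; `rfl`). -/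
theorem stir_two : stir 2 = fun x : UnitAddTorus (Fin 3) =>
    (Torus.stokesMode ![(0 : ℤ), 1, 1] (EuclideanSpace.single (0 : Fin 3) (1 : ℝ)) false x
      + Torus.stokesMode ![(1 : ℤ), 0, 1] (EuclideanSpace.single (1 : Fin 3) (1 : ℝ)) false x
      + Torus.stokesMode ![(1 : ℤ), 1, 0] (EuclideanSpace.single (2 : Fin 3) (1 : ℝ)) false x : EuclideanSpace ℝ (Fin 3)) := rfl

/-- The HALF-LATTICE SHIFT `h = (½, ½, ½) ∈ T³ = (ℝ/ℤ)³` (an element of order two). -/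
def halfShift : UnitAddTorus (Fin 3) := fun _ => ((2⁻¹ : ℝ) : UnitAddCircle)

/-- The POLE `e₂ = (0, 0, 1)` of the stirring sphere: the direction of the force `b₂`. -/
def pole : EuclideanSpace ℝ (Fin 3) := EuclideanSpace.single (2 : Fin 3) (1 : ℝ)

/-- The pole is a unit vector. -/
theorem norm_pole : ‖pole‖ = 1 := by
  simp [pole]

/-! ## Proved: parity of the stirring family under the half-lattice shift -/

/-- `e^{2πi(x+½)} = −e^{2πix}` on `ℝ/ℤ` (Mathlib `fourier_add_half_inv_index` with `T = 1`, `n = 1`). -/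
theorem fourier_one_add_half (x : UnitAddCircle) :
    @fourier 1 1 (x + ((2⁻¹ : ℝ) : UnitAddCircle)) = - fourier 1 x := by
  have h := @fourier_add_half_inv_index 1 1 one_ne_zero one_pos x
  simpa using h

/-- Shell-one monomials are ODD under the half-lattice shift: `e_k(x + h) = −e_k(x)` for `k = eᵢ`. -/
theorem mFourier_single_add_halfShift (x : UnitAddTorus (Fin 3)) (i : Fin 3) :
    UnitAddTorus.mFourier (Pi.single i (1 : ℤ)) (x + halfShift) =
      - UnitAddTorus.mFourier (Pi.single i (1 : ℤ)) x := by
  rw [UnitAddTorus.mFourier_single, UnitAddTorus.mFourier_single]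
  simp only [Pi.add_apply, halfShift]
  exact fourier_one_add_half (x i)

/-- Shell-two monomials are EVEN under the half-lattice shift: `e_k(x + h) = e_k(x)` for `k = eᵢ + eⱼ`. -/
theorem mFourier_pair_add_halfShift (x : UnitAddTorus (Fin 3)) (i j : Fin 3) :
    UnitAddTorus.mFourier (Pi.single i (1 : ℤ) + Pi.single j 1) (x + halfShift) =
      UnitAddTorus.mFourier (Pi.single i (1 : ℤ) + Pi.single j 1) x := by
  rw [UnitAddTorus.mFourier_add, UnitAddTorus.mFourier_add, mFourier_single_add_halfShift,
    mFourier_single_add_halfShift, neg_mul_neg]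

/-- `(0,1,1) = e₁ + e₂` in `ℤ³`. -/
theorem k011 : (![(0 : ℤ), 1, 1] : Fin 3 → ℤ) = Pi.single 1 1 + Pi.single 2 1 := by
  ext i; fin_cases i <;> simp

/-- `(1,0,1) = e₀ + e₂` in `ℤ³`. -/
theorem k101 : (![(1 : ℤ), 0, 1] : Fin 3 → ℤ) = Pi.single 0 1 + Pi.single 2 1 := by
  ext i; fin_cases i <;> simp

/-- `(1,1,0) = e₀ + e₁` in `ℤ³`. -/
theorem k110 : (![(1 : ℤ), 1, 0] : Fin 3 → ℤ) = Pi.single 0 1 + Pi.single 1 1 := by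
  ext i; fin_cases i <;> simp

/-- A shell-one Stokes mode is odd under the half-lattice shift. -/
theorem stokesMode_single_add_halfShift (i : Fin 3) (a : EuclideanSpace ℝ (Fin 3)) (cb : Bool)
    (x : UnitAddTorus (Fin 3)) :
    Torus.stokesMode (Pi.single i (1 : ℤ)) a cb (x + halfShift) = - Torus.stokesMode (Pi.single i (1 : ℤ)) a cb x := by
  rw [Torus.stokesMode_apply, Torus.stokesMode_apply, mFourier_single_add_halfShift]
  cases cb <;> simp [neg_smul]

/-- A shell-two Stokes mode with wave vector `eᵢ + eⱼ` is even under the half-lattice shift. -/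
theorem stokesMode_pair_add_halfShift (i j : Fin 3) (a : EuclideanSpace ℝ (Fin 3)) (cb : Bool)
    (x : UnitAddTorus (Fin 3)) :
    Torus.stokesMode (Pi.single i (1 : ℤ) + Pi.single j 1) a cb (x + halfShift) =
      Torus.stokesMode (Pi.single i (1 : ℤ) + Pi.single j 1) a cb x := by
  rw [Torus.stokesMode_apply, Torus.stokesMode_apply, mFourier_pair_add_halfShift]

/-- **Parity of the stirring family under the half-lattice shift** (the representation of `τ_h` on
`span(b₀, b₁, b₂)` is `diag(−1, −1, +1)`): `b₀(x + h) = −b₀(x)`, `b₁(x + h) = −b₁(x)`,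
`b₂(x + h) = b₂(x)`. [folklore] -/
theorem stir_parity (x : UnitAddTorus (Fin 3)) :
    stir 0 (x + halfShift) = - stir 0 x ∧ stir 1 (x + halfShift) = - stir 1 x ∧
      stir 2 (x + halfShift) = stir 2 x := by
  refine ⟨?_, ?_, ?_⟩
  · rw [stir_zero]; dsimp only
    rw [stokesMode_single_add_halfShift, stokesMode_single_add_halfShift, stokesMode_single_add_halfShift]
    abel
  · rw [stir_one]; dsimp only
    rw [stokesMode_single_add_halfShift, stokesMode_single_add_halfShift, stokesMode_single_add_halfShift]
    abel
  · rw [stir_two]; dsimp only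
    rw [k011, k101, k110, stokesMode_pair_add_halfShift, stokesMode_pair_add_halfShift,
      stokesMode_pair_add_halfShift]

/-- `b₀ ∘ τ_h = −b₀` as functions. -/
theorem stir_zero_comp_halfShift : (fun x => stir 0 (x + halfShift)) = -stir 0 :=
  funext fun x => by rw [Pi.neg_apply]; exact (stir_parity x).1

/-- `b₁ ∘ τ_h = −b₁` as functions. -/
theorem stir_one_comp_halfShift : (fun x => stir 1 (x + halfShift)) = -stir 1 :=
  funext fun x => by rw [Pi.neg_apply]; exact (stir_parity x).2.1

/-- `b₂ ∘ τ_h = b₂` as functions. -/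
theorem stir_two_comp_halfShift : (fun x => stir 2 (x + halfShift)) = stir 2 :=
  funext fun x => (stir_parity x).2.2

/-- Every member of the stirring family is continuous. -/
theorem continuous_stir (i : Fin 3) : Continuous (stir i) := by
  fin_cases i
  · show Continuous (stir 0); rw [stir_zero]; fun_prop
  · show Continuous (stir 1); rw [stir_one]; fun_prop
  · show Continuous (stir 2); rw [stir_two]; fun_prop

/-- Every member of the stirring family is smooth (finite sums of Stokes modes,
`Torus.isSmooth_stokesMode`). -/
theorem isSmooth_stir (i : Fin 3) : Torus.IsSmooth (stir i) := by
  fin_cases i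
  · show Torus.IsSmooth (stir 0); rw [stir_zero]
    exact ((Torus.isSmooth_stokesMode _ _ _).add (Torus.isSmooth_stokesMode _ _ _)).add (Torus.isSmooth_stokesMode _ _ _)
  · show Torus.IsSmooth (stir 1); rw [stir_one]
    exact ((Torus.isSmooth_stokesMode _ _ _).add (Torus.isSmooth_stokesMode _ _ _)).add (Torus.isSmooth_stokesMode _ _ _)
  · show Torus.IsSmooth (stir 2); rw [stir_two]
    exact ((Torus.isSmooth_stokesMode _ _ _).add (Torus.isSmooth_stokesMode _ _ _)).add (Torus.isSmooth_stokesMode _ _ _)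

/-- THE POLE DICTIONARY: the force of the stirring sphere at the pole `e₂` is `b₂`,
`Σᵢ (e₂)ᵢ bᵢ = b₂`. -/
theorem force_pole : (fun x : UnitAddTorus (Fin 3) => ∑ i : Fin 3, pole i • stir i x) = stir 2 := by
  funext x
  simp [pole]

/-- The `L²` pairing is odd in the field: `(u, −g) = −(u, g)` (no integrability needed: both sides are
the same Bochner integral up to `integral_neg`). -/
theorem pairing_neg (u : L2) (g : UnitAddTorus (Fin 3) → EuclideanSpace ℝ (Fin 3)) :
    Torus.pairing u (-g) = - Torus.pairing u g := by
  unfold Torus.pairing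
  simp [inner_neg_right, integral_neg]

/-! ## The two stub statements (named; the stubs below restate them verbatim) -/

/-- STUB 1 statement — TRANSLATION COVARIANCE OF THE FOIAS–PRODI CLASS. If the force `f` has the
period `h` (`f(x + h) = f(x)`), every stationary statistical solution `μ` of `NS_ν(f)` with integrable
energy has a TRANSLATE `μ'` (the push-forward of `μ` under `u ↦ u(· − h)` on `H`): again a stationary
statistical solution of `NS_ν(f)` with integrable energy, the same mean energy, and translated
correlations `∫ (u, g) dμ' = ∫ (u, g(· + h)) dμ` for every continuous field `g`. -/
def ShiftCovariance : Prop :=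
  ∀ (ν : ℝ) (h : UnitAddTorus (Fin 3)) (f : UnitAddTorus (Fin 3) → EuclideanSpace ℝ (Fin 3))
    (μ : Measure (Torus.energySpace (Fin 3))),
    Continuous f → (∀ x, f (x + h) = f x) →
    Torus.IsStationaryStatisticalSolution ν f μ →
    Integrable (fun u : Torus.energySpace (Fin 3) => ‖u‖ ^ 2) μ →
      ∃ μ' : Measure (Torus.energySpace (Fin 3)),
        Torus.IsStationaryStatisticalSolution ν f μ' ∧
        Integrable (fun u : Torus.energySpace (Fin 3) => ‖u‖ ^ 2) μ' ∧
        Torus.ensembleEnergy μ' = Torus.ensembleEnergy μ ∧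
        ∀ g : UnitAddTorus (Fin 3) → EuclideanSpace ℝ (Fin 3), Continuous g →
          ∫ u, Torus.pairing (u : Lp (EuclideanSpace ℝ (Fin 3)) 2 (volume : Measure (UnitAddTorus (Fin 3)))) g ∂μ' =
            ∫ u, Torus.pairing (u : Lp (EuclideanSpace ℝ (Fin 3)) 2 (volume : Measure (UnitAddTorus (Fin 3)))) (fun x => g (x + h)) ∂μ

/-- STUB 2 statement — MIDPOINT CONVEXITY OF THE BOUNDED FOIAS–PRODI CLASS. Two stationary
statistical solutions `μ₁, μ₂` of `NS_ν(f)` with integrable energy have a MIDPOINT `μ̄` (the measure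
`½(μ₁ + μ₂)`): a stationary statistical solution of `NS_ν(f)` with integrable energy, mean energy the
average of the two, and averaged correlations `∫ (u, g) dμ̄ = ½(∫ (u, g) dμ₁ + ∫ (u, g) dμ₂)` for every
continuous field `g`. -/
def MidpointConvexity : Prop :=
  ∀ (ν : ℝ) (f : UnitAddTorus (Fin 3) → EuclideanSpace ℝ (Fin 3))
    (μ₁ μ₂ : Measure (Torus.energySpace (Fin 3))),
    Continuous f →
    Torus.IsStationaryStatisticalSolution ν f μ₁ → Torus.IsStationaryStatisticalSolution ν f μ₂ →
    Integrable (fun u : Torus.energySpace (Fin 3) => ‖u‖ ^ 2) μ₁ →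
    Integrable (fun u : Torus.energySpace (Fin 3) => ‖u‖ ^ 2) μ₂ →
      ∃ μ₃ : Measure (Torus.energySpace (Fin 3)),
        Torus.IsStationaryStatisticalSolution ν f μ₃ ∧
        Integrable (fun u : Torus.energySpace (Fin 3) => ‖u‖ ^ 2) μ₃ ∧
        Torus.ensembleEnergy μ₃ = (Torus.ensembleEnergy μ₁ + Torus.ensembleEnergy μ₂) / 2 ∧
        ∀ g : UnitAddTorus (Fin 3) → EuclideanSpace ℝ (Fin 3), Continuous g →
          ∫ u, Torus.pairing (u : Lp (EuclideanSpace ℝ (Fin 3)) 2 (volume : Measure (UnitAddTorus (Fin 3)))) g ∂μ₃ =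
            ((∫ u, Torus.pairing (u : Lp (EuclideanSpace ℝ (Fin 3)) 2 (volume : Measure (UnitAddTorus (Fin 3)))) g ∂μ₁) +
              ∫ u, Torus.pairing (u : Lp (EuclideanSpace ℝ (Fin 3)) 2 (volume : Measure (UnitAddTorus (Fin 3)))) g ∂μ₂) / 2

/-! ## The stubs -/

/-- **stub 1 — translation covariance of stationary statistical solutions** (HARDEST stub of the
line; size L; pure bookkeeping on FMRT IV Def. 1.3, zero mathematical risk). For a force with period
`h` and a stationary statistical solution `μ` of `NS_ν(f)` with integrable energy, the push-forward
`μ' := (T_h)_* μ` under the translation `T_h : H → H`, `(T_h u)(x) = u(x − h)` — the restriction to the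
closed invariant subspace `H` of the linear isometry `Lp.compMeasurePreserving (· − h)
(measurePreserving_sub_right volume h)` of `L²(T³; ℝ³)` (`H = closure (span 𝒱)` and `𝒱` = smooth
solenoidal mean-zero fields is translation invariant; or use `Torus.mem_energySpace_iff`: weak
divergence-freeness and zero mean are translation invariant) — witnesses the stub:
* `T_h` is a linear isometric homeomorphism of `H`, hence a `MeasurableEquiv` (Borel σ-algebra
  `Torus.instBorelSpaceEnergySpace`); `μ'` is a probability measure; `∫ F dμ' = ∫ F ∘ T_h dμ`
  (`MeasurableEquiv.integral_map`, `integrable_map_equiv`; pattern: the landed reflection symmetrisation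
  `Theorems/TameRoughRigidityTameClosureSymmetrise.lean`, lines `hIν`/`hIntν`);
* ENERGY / CORRELATIONS: `‖T_h u‖ = ‖u‖`; `(T_h u, g) = ∫ ⟪u(x − h), g(x)⟫ dx = ∫ ⟪u(z), g(z + h)⟫ dz =
  (u, g(· + h))` for every `u ∈ L²` and every `g` (Haar invariance `integral_add_right_eq_self` /
  `integral_sub_right_eq_self` on the compact group `T³`; the representative of `T_h u` is a.e.
  `u ∘ (· − h)`, `Lp.coeFn_compMeasurePreserving`) — gives the last two clauses and `Integrable ‖u‖²`;
* ENSTROPHY (1.29): `eGradNormSq (T_h u) = eGradNormSq u` — the Fourier coefficients of a translate are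
  unimodular multiples, `𝓕(u ∘ (· − h))(k) = e^{−2πik·h} 𝓕u(k)` (`mFourierCoeff` and Haar invariance,
  `Torus.mFourierCoeff_congr_ae`, `Torus.eGradNormSq_eq_tsum`), so `∫⁻ ‖·‖²_V dμ' = ∫⁻ ‖·‖²_V dμ < ∞`;
* LIOUVILLE (1.30): for a cylindrical test `Φ = φ((·,g₁),…,(·,gₘ))` let `Φₕ` be the cylindrical test
  with the translated fields `gᵢ(· + h)` (smooth, solenoidal, mean zero — `Torus.IsSmooth`,
  `IsDivFree`, `HasZeroMean` are translation invariant) and the same `φ`; then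
  `Φ.coords (T_h u) = Φₕ.coords u`, `Φ.grad (T_h u) = (Φₕ.grad u)(· − h)` and, `f` being `h`-periodic
  and `Torus.fderiv` / `Torus.laplacian` commuting with translations,
  `⟨F(T_h u), Φ'(T_h u)⟩ = ⟨F(u), Φₕ'(u)⟩` (`Torus.nsGeneratorPairing`: the three summands are integrals
  over `T³` of translates); hence integrability and `∫ ⟨F, Φ'⟩ dμ' = ∫ ⟨F, Φₕ'⟩ dμ = 0` from
  `μ.generator Φₕ`;
* SHELLS (1.31): the shell `{e₁ ≤ |u|² < e₂}` is `T_h`-invariant and the integrand transforms as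
  `ν‖T_h u‖²_V − (T_h u, f) = ν‖u‖²_V − (u, f(· + h)) = ν‖u‖²_V − (u, f)`, so each shell inequality
  of `μ'` IS the corresponding shell inequality of `μ` (`MeasurableEquiv.restrict_map`,
  `setIntegral_map_equiv`).
Why it might fail: it does not (every clause is an identity under an isometry of `H` that fixes the
equation); the only traps are Lean-side — the `H`-membership of translates (prove it on `𝒱` and pass to
span/closure, or via `mem_energySpace_iff_holds`) and the a.e.-representative bookkeeping of `Lp`.
Leans on (ALL IN TREE, proved): translation calculus on `T^d` —
`FunctionSpaces.Torus.IsSmooth.comp_add_right` (`FlatTorus`), `FluidPDE.Torus.liftAt_comp_add_right`,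
`FluidPDE.Torus.laplacian_comp_add_right`, `FluidPDE.Torus.partialDeriv_comp_add_right`
(`PressureBesovRegularity`), `FunctionSpaces.Torus.mFourierCoeff_comp_add_right`
(`TorusHolderSobolevEmbedding`), `FluidPDE.Torus.eGradNormSq_comp_add_right` (`LerayHopfGalileanTorusTools`);
the statistical-solution calculus — `StatisticalSolution` (Def. 1.3), `CylindricalGenerator`
(`nsGeneratorPairing_grad`, `continuous_nsGeneratorPairing_grad`), `StatisticalSolutionEnergyEq` /
`StatisticalSolutionProofs` (`integrable_pairing`, `continuous_pairing_coe`, `integrable_toReal_eGradNormSq`),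
`EnergySpaceTorusProofs` (`mem_energySpace_iff_holds`); the landed symmetrisation pattern for the
involution `v ↦ −v` (`Theorems/TameRoughRigidityTameClosureSymmetrise.lean`,
`Theorems/EnsembleRigidityGPStatisticalRigidityDesaturation.lean`: `desaturation_exists_reflect` is the
model for the translated cylindrical test); Mathlib `Lp.compMeasurePreserving(ₗᵢ)`,
`measurePreserving_add_right` / `measurePreserving_sub_right` (Haar on the compact group `T³`),
`MeasurableEquiv`, `integral_map_equiv`, `integrable_map_equiv`, `integral_add_right_eq_self`.
[FMRTTurbulence2001 Ch. IV §1.2 Def. 1.3 (1.29)–(1.31); VishikFursikov1988 Ch. VII (space-homogeneous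
statistical solutions); Frisch1995 §6.1] -/
theorem stub_shiftCovariance :
    ∀ (ν : ℝ) (h : UnitAddTorus (Fin 3)) (f : UnitAddTorus (Fin 3) → EuclideanSpace ℝ (Fin 3))
      (μ : Measure (Torus.energySpace (Fin 3))),
      Continuous f → (∀ x, f (x + h) = f x) →
      Torus.IsStationaryStatisticalSolution ν f μ →
      Integrable (fun u : Torus.energySpace (Fin 3) => ‖u‖ ^ 2) μ →
        ∃ μ' : Measure (Torus.energySpace (Fin 3)),
          Torus.IsStationaryStatisticalSolution ν f μ' ∧
          Integrable (fun u : Torus.energySpace (Fin 3) => ‖u‖ ^ 2) μ' ∧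
          Torus.ensembleEnergy μ' = Torus.ensembleEnergy μ ∧
          ∀ g : UnitAddTorus (Fin 3) → EuclideanSpace ℝ (Fin 3), Continuous g →
            ∫ u, Torus.pairing (u : Lp (EuclideanSpace ℝ (Fin 3)) 2 (volume : Measure (UnitAddTorus (Fin 3)))) g ∂μ' =
              ∫ u, Torus.pairing (u : Lp (EuclideanSpace ℝ (Fin 3)) 2 (volume : Measure (UnitAddTorus (Fin 3)))) (fun x => g (x + h)) ∂μ := by
  sorry

/-- **stub 2 — midpoint convexity of the bounded Foias–Prodi class** (size M; measure bookkeeping).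
The witness is `μ₃ := (2⁻¹ : ℝ≥0∞) • (μ₁ + μ₂)`: `IsProbabilityMeasure` ✓; finite mean enstrophy
(`lintegral_add_measure`, `lintegral_smul_measure`) ✓; the Liouville identity with its integrability
clause (`integrable_add_measure`, `Integrable.smul_measure`, `integral_add_measure`,
`integral_smul_measure`: `½(0 + 0) = 0`) ✓; every shell energy inequality
`∫_{e₁ ≤ |u|² < e₂} (ν‖u‖²_V − (f,u)) dμ₃ ≤ 0` ✓ — the integrand is integrable on the shell for both
measures (`integrable_toReal_eGradNormSq`, `integrable_pairing`, `f` continuous hence `MemLp f 2`), so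
the set integral (`Measure.restrict_add`, `Measure.restrict_smul`) is the average of two nonpositive
numbers (and in the junk case — not integrable for one of them, hence not for `μ₃` — the Bochner value
`0 ≤ 0` holds anyway); `Integrable ‖u‖²` and `∫ ‖u‖² dμ₃ = ½(E₁ + E₂)` ✓; the correlation clause from
`integral_add_measure` / `integral_smul_measure` and the integrability of `u ↦ (u, g)`
(`IsStationaryStatisticalSolution.integrable_pairing`, `g` continuous). Pattern: the landed
`Theorems/TameRoughRigidityTameClosureSymmetrise.lean` (`hprob'`, `hInt'`, `hI`) does exactly this for
`½(μ + T_*μ)`. Why it might fail: it should not (the only trap is the `ℝ≥0∞` scalar action on `Measure`,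
use `(2⁻¹ : ℝ≥0∞)` and `ENNReal.toReal_inv`). Leans on: Mathlib measure algebra;
`IsStationaryStatisticalSolution` (structure, four fields). [FMRTTurbulence2001 Ch. IV §1.2 (the class
of stationary statistical solutions is convex)] -/
theorem stub_midpointConvexity :
    ∀ (ν : ℝ) (f : UnitAddTorus (Fin 3) → EuclideanSpace ℝ (Fin 3))
      (μ₁ μ₂ : Measure (Torus.energySpace (Fin 3))),
      Continuous f →
      Torus.IsStationaryStatisticalSolution ν f μ₁ → Torus.IsStationaryStatisticalSolution ν f μ₂ →
      Integrable (fun u : Torus.energySpace (Fin 3) => ‖u‖ ^ 2) μ₁ →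
      Integrable (fun u : Torus.energySpace (Fin 3) => ‖u‖ ^ 2) μ₂ →
        ∃ μ₃ : Measure (Torus.energySpace (Fin 3)),
          Torus.IsStationaryStatisticalSolution ν f μ₃ ∧
          Integrable (fun u : Torus.energySpace (Fin 3) => ‖u‖ ^ 2) μ₃ ∧
          Torus.ensembleEnergy μ₃ = (Torus.ensembleEnergy μ₁ + Torus.ensembleEnergy μ₂) / 2 ∧
          ∀ g : UnitAddTorus (Fin 3) → EuclideanSpace ℝ (Fin 3), Continuous g →
            ∫ u, Torus.pairing (u : Lp (EuclideanSpace ℝ (Fin 3)) 2 (volume : Measure (UnitAddTorus (Fin 3)))) g ∂μ₃ =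
              ((∫ u, Torus.pairing (u : Lp (EuclideanSpace ℝ (Fin 3)) 2 (volume : Measure (UnitAddTorus (Fin 3)))) g ∂μ₁) +
                ∫ u, Torus.pairing (u : Lp (EuclideanSpace ℝ (Fin 3)) 2 (volume : Measure (UnitAddTorus (Fin 3)))) g ∂μ₂) / 2 := by
  sorry

/-! ## Name-keyed aliases of the stub statements — the hypotheses of `HairyBallAlignment_of`

The native skeleton audit (`#h21_check_skeleton`, run by `ledger skeleton check`) admits a hypothesis of
the composing theorem only if its head constant is a registered obligation or is NAMED like a declared
stub; `__Registered.stub_X` is statement `X` under the registered stub's short name (device of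
`Lines/birth.lean`). Each alias is an `abbrev`, definitionally its statement. -/
namespace __Registered

/-- Alias of `ShiftCovariance` keyed by the registered stub name. -/
abbrev stub_shiftCovariance : Prop := ShiftCovariance
/-- Alias of `MidpointConvexity` keyed by the registered stub name. -/
abbrev stub_midpointConvexity : Prop := MidpointConvexity

end __Registered

/-! Registered-signature agreement: each stub theorem's signature is, definitionally, the named statement
it witnesses (`Iff.rfl`; only TYPES are compared, no `sorry` enters). -/
example : (∀ (ν : ℝ) (h : UnitAddTorus (Fin 3)) (f : UnitAddTorus (Fin 3) → EuclideanSpace ℝ (Fin 3))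
      (μ : Measure (Torus.energySpace (Fin 3))),
      Continuous f → (∀ x, f (x + h) = f x) →
      Torus.IsStationaryStatisticalSolution ν f μ →
      Integrable (fun u : Torus.energySpace (Fin 3) => ‖u‖ ^ 2) μ →
        ∃ μ' : Measure (Torus.energySpace (Fin 3)),
          Torus.IsStationaryStatisticalSolution ν f μ' ∧
          Integrable (fun u : Torus.energySpace (Fin 3) => ‖u‖ ^ 2) μ' ∧
          Torus.ensembleEnergy μ' = Torus.ensembleEnergy μ ∧
          ∀ g : UnitAddTorus (Fin 3) → EuclideanSpace ℝ (Fin 3), Continuous g →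
            ∫ u, Torus.pairing (u : Lp (EuclideanSpace ℝ (Fin 3)) 2 (volume : Measure (UnitAddTorus (Fin 3)))) g ∂μ' =
              ∫ u, Torus.pairing (u : Lp (EuclideanSpace ℝ (Fin 3)) 2 (volume : Measure (UnitAddTorus (Fin 3)))) (fun x => g (x + h)) ∂μ) ↔
    __Registered.stub_shiftCovariance := Iff.rfl
example : (∀ (ν : ℝ) (f : UnitAddTorus (Fin 3) → EuclideanSpace ℝ (Fin 3))
      (μ₁ μ₂ : Measure (Torus.energySpace (Fin 3))),
      Continuous f →
      Torus.IsStationaryStatisticalSolution ν f μ₁ → Torus.IsStationaryStatisticalSolution ν f μ₂ →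
      Integrable (fun u : Torus.energySpace (Fin 3) => ‖u‖ ^ 2) μ₁ →
      Integrable (fun u : Torus.energySpace (Fin 3) => ‖u‖ ^ 2) μ₂ →
        ∃ μ₃ : Measure (Torus.energySpace (Fin 3)),
          Torus.IsStationaryStatisticalSolution ν f μ₃ ∧
          Integrable (fun u : Torus.energySpace (Fin 3) => ‖u‖ ^ 2) μ₃ ∧
          Torus.ensembleEnergy μ₃ = (Torus.ensembleEnergy μ₁ + Torus.ensembleEnergy μ₂) / 2 ∧
          ∀ g : UnitAddTorus (Fin 3) → EuclideanSpace ℝ (Fin 3), Continuous g →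
            ∫ u, Torus.pairing (u : Lp (EuclideanSpace ℝ (Fin 3)) 2 (volume : Measure (UnitAddTorus (Fin 3)))) g ∂μ₃ =
              ((∫ u, Torus.pairing (u : Lp (EuclideanSpace ℝ (Fin 3)) 2 (volume : Measure (UnitAddTorus (Fin 3)))) g ∂μ₁) +
                ∫ u, Torus.pairing (u : Lp (EuclideanSpace ℝ (Fin 3)) 2 (volume : Measure (UnitAddTorus (Fin 3)))) g ∂μ₂) / 2) ↔
    __Registered.stub_midpointConvexity := Iff.rfl

/-! ## Proved: the composition -/

/-- **Composition** (kernel-checked, no `sorry` of its own): translation covariance and midpoint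
convexity of the Foias–Prodi class imply the crux
`Summit.AnomalousDissipation.AnomalousDissipation.Theses.StirringSphere.HairyBallAlignment` BY NAME.
`E, ν₀` from `BoundedSphereStatistics`; `ν₁, m₀` from `NoScreening` at level `E`; for `ν < min ν₀ ν₁`
take the POLE `c = e₂` and the bounded statistics `μ` of `NS_ν(b₂)` handed out there; translate it by
the half-lattice shift (stub 1: `b₂` is `h`-periodic by `stir_parity`) and average (stub 2): the
symmetrised `μ̄` is admissible with energy `≤ E` and responses `(0, 0, y₂(μ))` (`stir_parity`:
`b₀, b₁` are `h`-odd, `b₂` is `h`-even); `NoScreening` at `(e₂, μ̄)` gives `m₀² ≤ y₂(μ)²`, the mean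
energy inequality (`energy_le_holds`) gives `y₂(μ) = injection ≥ 0`, hence injection `(μ) ≥ m₀`.
[folklore] -/
theorem HairyBallAlignment_of :
    __Registered.stub_shiftCovariance → __Registered.stub_midpointConvexity → HairyBallAlignment := by
  intro hCov hMid
  dsimp only [__Registered.stub_shiftCovariance, __Registered.stub_midpointConvexity, ShiftCovariance,
    MidpointConvexity] at hCov hMid
  intro hNS hBSS b hb
  obtain rfl : b = stir := hb
  -- bounded statistics on the whole sphere: the level `E` and the threshold `ν₀`
  obtain ⟨E, ν₀, hE, hν₀, hbdd⟩ := hBSS stir stir_eq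
  -- no screening at level `E`: the threshold `ν₁` and the floor `m₀`
  obtain ⟨ν₁, m₀, hν₁, hm₀, hns⟩ := hNS stir stir_eq E hE
  refine ⟨E, min ν₀ ν₁, m₀, hE, lt_min hν₀ hν₁, hm₀, fun ν hν hνlt => ?_⟩
  have hν0 : ν < ν₀ := lt_of_lt_of_le hνlt (min_le_left _ _)
  have hν1 : ν < ν₁ := lt_of_lt_of_le hνlt (min_le_right _ _)
  -- bounded statistics AT THE POLE: this `μ` is the witness
  obtain ⟨μ, hstat, hint, hEμ⟩ := hbdd pole norm_pole ν hν hν0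
  refine ⟨pole, μ, norm_pole, hstat, hint, hEμ, ?_⟩
  -- the force at the pole is `b₂`: continuous and `h`-periodic
  have hcont : Continuous (fun x : UnitAddTorus (Fin 3) => ∑ i : Fin 3, pole i • stir i x) := by
    rw [force_pole]; exact continuous_stir 2
  have hinv : ∀ x : UnitAddTorus (Fin 3),
      (∑ i : Fin 3, pole i • stir i (x + halfShift)) = ∑ i : Fin 3, pole i • stir i x := by
    intro x
    have h1 := congr_fun force_pole (x + halfShift)
    have h2 := congr_fun force_pole x
    simp only at h1 h2
    rw [h1, h2]
    exact (stir_parity x).2.2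
  -- the translated statistics (stub 1) and the symmetrised statistics (stub 2)
  obtain ⟨μ', hstat', hint', hE', hpair'⟩ := hCov ν halfShift _ μ hcont hinv hstat hint
  obtain ⟨μb, hstatb, hintb, hEb, hpairb⟩ := hMid ν _ μ μ' hcont hstat hstat' hint hint'
  have hEb' : Torus.ensembleEnergy μb ≤ E := by rw [hEb, hE']; linarith
  -- no screening at the pole for the symmetrised statistics
  have hm : m₀ ^ 2 ≤ ∑ i : Fin 3, (∫ u, Torus.pairing (u : L2) (stir i) ∂μb) ^ 2 :=
    hns pole norm_pole ν hν hν1 μb hstatb hintb hEb'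
  -- the three responses of the symmetrised statistics: `(0, 0, y₂(μ))`
  have y0 : ∫ u, Torus.pairing (u : L2) (stir 0) ∂μb = 0 := by
    rw [hpairb _ (continuous_stir 0), hpair' _ (continuous_stir 0), stir_zero_comp_halfShift]
    simp only [pairing_neg, integral_neg]
    ring
  have y1 : ∫ u, Torus.pairing (u : L2) (stir 1) ∂μb = 0 := by
    rw [hpairb _ (continuous_stir 1), hpair' _ (continuous_stir 1), stir_one_comp_halfShift]
    simp only [pairing_neg, integral_neg]
    ring
  have y2 : ∫ u, Torus.pairing (u : L2) (stir 2) ∂μb = ∫ u, Torus.pairing (u : L2) (stir 2) ∂μ := by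
    rw [hpairb _ (continuous_stir 2), hpair' _ (continuous_stir 2), stir_two_comp_halfShift]
    ring
  rw [Fin.sum_univ_three, y0, y1, y2] at hm
  have hy2 : m₀ ^ 2 ≤ (∫ u, Torus.pairing (u : L2) (stir 2) ∂μ) ^ 2 := by simpa using hm
  -- the injection at the pole is nonnegative (mean energy inequality, FMRT IV (1.31))
  have hstat2 : Torus.IsStationaryStatisticalSolution ν (stir 2) μ := by
    rw [force_pole] at hstat; exact hstat
  have hnn : 0 ≤ ∫ u, Torus.pairing (u : L2) (stir 2) ∂μ := by
    have h := Torus.IsStationaryStatisticalSolution.energy_le_holds hstat2 ((isSmooth_stir 2).memLp 2)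
    have h0 : 0 ≤ ν * (Torus.ensembleEnstrophy μ).toReal := mul_nonneg hν.le ENNReal.toReal_nonneg
    linarith
  have hle : m₀ ≤ ∫ u, Torus.pairing (u : L2) (stir 2) ∂μ := by
    have h := Real.sqrt_le_sqrt hy2
    rwa [Real.sqrt_sq hm₀.le, Real.sqrt_sq hnn] at h
  -- injection `(μ) = y₂(μ) ≥ m₀`
  rw [force_pole]
  exact hle

/-- WIRING CHECK: the two sorried stubs compose to a closed term of the crux's type (modulo their
`sorry`s). Deliberately an `example` (no constant enters the environment), so that a probe importing
this file could not close `stub → HairyBallAlignment` by `exact?` through a pre-composed witness. -/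
example : HairyBallAlignment :=
  HairyBallAlignment_of stub_shiftCovariance stub_midpointConvexity

end Summit.AnomalousDissipation.AnomalousDissipation.Cruxes.HairyBallAlignment.Pole

end
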